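import Literature.MathematicalPhysics.QuantumFieldTheory.ConformalBootstrap3D.PointKernelK34L515.Cert

/-!
# K34L515 instance, cell `l6c9` (parts file: groups 0:32)

Kernel-v3 cell of the point-functional exclusion instance for the lower box `Δσ ∈ [0.515, 0.520]`,
`Δε ∈ [0.6, 0.95)` (certificate `certL515`, module `PointKernelK34L515.Cert`): spin `ℓ = 6`,
`Δ ∈ [243/32, 245/32)` (centre `A`, half-width `2^-5`), Taylor degree `4`, `n_F = 50`, `1` s-piece(s)
covering `s = Δσ ∈ [103/200, 13/25]`.  Group theorems `l6c9_part<i>_<a>_<b> : gPart … = some <literal>` are checked by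
`decide +kernel` (the literals were produced by `#eval` of the same function); the cell numbers `l6c9_num<i> ≥ 0`
likewise; `l6c9_block` is `PKTM.blockPositive_of_cellPass` applied to them. This file holds only group theorems (the cell stated as a literal); the final file of the cell imports it.  Generated by
`gen/mk_v3cell.py` / `gen/drive_v3.py` (typer-g8).  [folklore]
-/

set_option Elab.async false

namespace Literature.MathematicalPhysics.QuantumFieldTheory.ConformalBootstrap3D

namespace PointKernelK34L515

open PointKernel PKTM
open Literature.Analysis.ValidatedNumerics.PolyMP
open Literature.Analysis.ValidatedNumerics.NumericsMP

/-- group model literal [folklore] -/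
def l6c9_g0_32_34 : G3 := ([⟨565642517689285770658183425522855015041, 565642517724551107508493653217006787762⟩, ⟨58149253809639368452790430554563710366, 58149253866712723164164745419747247013⟩, ⟨-131462684871253642385222275166132632, -131462610801996724242446942211516728⟩, ⟨1613095752624263749267825882250873170, 1613095828109441805217660794208123651⟩, ⟨-904146365017457062427745037381304766, -904146300029529314771793338546030841⟩], [⟨-6817549024481009611739643502657647087, -6817549024058450872460406210369774509⟩, ⟨-696445474406646841021209229454545740, -696445473719044040661459736175133810⟩, ⟨-824794930622540331380478137497886, -824794038153737065135214297733594⟩, ⟨-18677061395020707909550692327135954, -18677060485364711710372027444689248⟩, ⟨10696987717209386452520287896918445, 10696988500486715886003656660244922⟩], [⟨41562526194752530005384302344469678, 41562526197324217433795457319567333⟩, ⟨4240167706872133761120419236438251, 4240167711064737654944380218802685⟩, ⟨10869447887896639881673652535979, 10869453330411518256223985635729⟩, ⟨112352077057527375251521866924763, 112352082605854351141846409042446⟩, ⟨-64784418410819474062754155304798, -64784413632340531609536756457574⟩])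

/-- group `[32, 34)` of piece 0 [folklore] -/
theorem l6c9_part0_32_34 : gPart certL515 (⟨6, ((61 : ℚ) / 8), 5, 4, 50, 6, 64, ⟨3, 0, 5, 104, 0, 0⟩⟩ : TMCell) (pc ps1 0) 32 34 = some l6c9_g0_32_34 := by decide +kernel

end PointKernelK34L515

end Literature.MathematicalPhysics.QuantumFieldTheory.ConformalBootstrap3D
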